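import Mathlib
import Summits.KontsevichZagierPeriods.Zeta5Search.ClusterValuation
import Summits.KontsevichZagierPeriods.Zeta5Search.BigPrimeMinors
import HarnessLib

/-!
# ζ(5) search — cluster valuation theory, part 2: the global residue split `W = Ω_p(b) − 𝒦_p(b)` (gen-2 g8, §4)

Cell `pub-zeta5`; HONEST FRAMING: systematic search; no irrationality claim unless certified.
This is §4 of gen-2 g8's staged statement file `HOME/lean/G8ClusterValuation.lean` (sha256 6eae9a9156b3a6db…), split VERBATIM
by typer g7 for the 400-line limit (part 1 = `ClusterValuation.lean`, §1–§3; part 3 = `ClusterValuationChecks.lean`, §5).  Contents: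
moments `momentAt`, the OBSERVED/paper-proved statements `MomentVanishing`, `MomentIntegral`, the residue pieces `taylorTT/omegaRes/kRes`
with the PROVED algebra `coeffW_eq_omegaRes_sub_kRes`, `omegaRes_eq_moments`, `casoratian_split`, the two OBSERVED laws
`ConstantTermFloorLaw` (V-floor) and `KResCasoratianLaw` (CV-𝒦), and the PROVED reduction
`casoratianValuationLaw_of : MomentVanishing → MomentIntegral → ConstantTermFloorLaw → KResCasoratianLaw → CasoratianValuationLaw`
(valuation bookkeeping only; (CV) itself stays a conjecture).  See part 1 for coordinates and the paper references (REPORT-gen2-g6/g7/g8).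
-/

open Finset

namespace Summit.KontsevichZagierPeriods.Zeta5Search.ClusterValuation

open Summit.KontsevichZagierPeriods.Zeta5Search.DualSeries (InBox)
open Summit.KontsevichZagierPeriods.Zeta5Search.WedgeDictionary (coeffU coeffW coeffV pfData dOf)
open Summit.KontsevichZagierPeriods.Zeta5Search.CasoratianValuation (InPolytope pairFloors refund refundW topPartners
  shift casoratian CasoratianValuationLaw)
open Summit.KontsevichZagierPeriods.Zeta5Search.BigPrime (block)

/-! ## §4 The global residue split (NEW, g8) -/

/-- The `N`-th MOMENT of `R_b` at infinity computed from the partial fractions: `μ_N(b) = [t^{−N}] R_b(t)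
= Σ_{o,q} c_{o,q} · C(N−1, o) · (−(q+1))^{N−1−o}` (expansion of `(t+q+1)^{−(o+1)}` at `t = ∞`). -/
noncomputable def momentAt (b : ℕ → ℤ) (N : ℕ) : ℚ :=
  ∑ o ∈ range 6, ∑ q ∈ range ((b 0).toNat + 1),
    pfData b o q * ((N - 1).choose o : ℚ) * (-((q : ℚ) + 1)) ^ (N - 1 - o)

/-- **MOMENT VANISHING (support; the residue theorem for `R_b`)**: `deg R_b = −(2d(b)+5)` (numerator degree `1 + 2Σb_j`,
denominator `6(b₀+1)`), hence `μ_N(b) = 0` for `1 ≤ N ≤ 2d(b)+4`.  (g8 exact check: `Ω_p(b) = 0 ⟺ p ≤ d+1` and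
`Ω_p(b⁺) = 0 ⟺ p ≤ d` in 1,620/1,620 pairs.)  Requires the series to converge: `InPolytope`. -/
@[conjecture] def MomentVanishing : Prop :=
  ∀ (b : ℕ → ℤ) (N : ℕ), InPolytope b → 1 ≤ N → (N : ℤ) ≤ 2 * dOf b + 4 → momentAt b N = 0

/-- **MOMENT INTEGRALITY (support)**: `μ_N(b) ∈ ℤ[1/2]` (it is `2·[u^{N−2d−5}] ∏_q (1 + (q+1)u)^{netExp}·(1 + (b₀+2)u/2)` with integer
exponents), so `μ_N(b)` is `p`-integral for every odd prime. -/
@[conjecture] def MomentIntegral : Prop :=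
  ∀ (b : ℕ → ℤ) (N p : ℕ), InPolytope b → p.Prime → 3 ≤ p → momentAt b N ≠ 0 → 0 ≤ padicValRat p (momentAt b N)

/-- Taylor coefficient `g_o(k) = [(t+k)^o] (t^p − t)² = [(t+k)^o](t^{2p} − 2t^{p+1} + t²)` (an integer; for `o ≠ 2`, and for
`o = 2` after subtracting `1`, it is DIVISIBLE BY `p` as soon as `o ≤ p`: `(t^p−t)² ≡ ((t+k)^p − (t+k))² (mod p)`). -/
def taylorTT (p o : ℕ) (k : ℤ) : ℤ :=
  ((2 * p).choose o : ℤ) * (-k) ^ (2 * p - o) - 2 * ((p + 1).choose o : ℤ) * (-k) ^ (p + 1 - o)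
    + ((2 : ℕ).choose o : ℤ) * (-k) ^ (2 - o)

/-- `Ω_p(b) := Σ_q Res_{y=−q} (t^p − t)² R_b = Σ_{o,q} c_{o,q} g_o(q+1)`  (`t = y − 1`, pole `t = −(q+1)`). -/
noncomputable def omegaRes (b : ℕ → ℤ) (p : ℕ) : ℚ :=
  ∑ o ∈ range 6, ∑ q ∈ range ((b 0).toNat + 1), pfData b o q * (taylorTT p o ((q : ℤ) + 1) : ℚ)

/-- `𝒦_p(b) := Σ_q Res_{t=−(q+1)} [((t^p − t)² − (t+q+1)²) R_b] = Σ_{o,q} c_{o,q} (g_o(q+1) − [o = 2])`; every coefficient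
`g_o(q+1) − [o=2]` (`o < 6 ≤ p`) is divisible by `p`. -/
noncomputable def kRes (b : ℕ → ℤ) (p : ℕ) : ℚ :=
  ∑ o ∈ range 6, ∑ q ∈ range ((b 0).toNat + 1),
    pfData b o q * ((taylorTT p o ((q : ℤ) + 1) : ℚ) - if o = 2 then 1 else 0)

/-- **`W = Ω_p − 𝒦_p`** (definitional algebra). -/
theorem coeffW_eq_omegaRes_sub_kRes (b : ℕ → ℤ) (p : ℕ) : coeffW b = omegaRes b p - kRes b p := by
  simp only [coeffW, omegaRes, kRes, ← Finset.sum_sub_distrib, mul_sub, sub_sub_cancel, mul_ite, mul_one, mul_zero]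
  rw [Finset.sum_comm]
  refine Finset.sum_congr rfl fun q _ => ?_
  rw [Finset.sum_ite_eq' (range 6) 2 (fun o => pfData b o q)]
  simp

/-- **`Ω_p = μ_{2p+1} − 2μ_{p+2} + μ_3`** (so `MomentVanishing` gives `Ω_p(b) = 0` for `p ≤ d(b)+1`, i.e. `2p+1 ≤ 2d+4`). -/
theorem omegaRes_eq_moments (b : ℕ → ℤ) (p : ℕ) :
    omegaRes b p = momentAt b (2 * p + 1) - 2 * momentAt b (p + 2) + momentAt b 3 := by
  simp only [omegaRes, momentAt, taylorTT, Finset.mul_sum, ← Finset.sum_sub_distrib, ← Finset.sum_add_distrib]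
  refine Finset.sum_congr rfl fun o _ => Finset.sum_congr rfl fun q _ => ?_
  have h1 : 2 * p + 1 - 1 = 2 * p := by omega
  have h2 : p + 2 - 1 = p + 1 := by omega
  rw [h1, h2]
  push_cast
  ring

/-- **THE CASORATIAN SPLITS** (definitional algebra from `W = Ω_p − 𝒦_p` applied to `b` and `b + e_j`):
`Cas_j(b) = [Ω_p(b⁺)V(b) − Ω_p(b)V(b⁺)] − [𝒦_p(b⁺)V(b) − 𝒦_p(b)V(b⁺)]`.  For `p ≤ d(b)` BOTH `Ω`'s vanish
(`d(b⁺) = d(b) − 1`), so `Cas_j(b) = 𝒦_p(b)V(b⁺) − 𝒦_p(b⁺)V(b)`; at `p = d(b)+1` only `Ω_p(b)` vanishes — this is exactly the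
refund `[p ≤ d]` of (CV). -/
theorem casoratian_split (b : ℕ → ℤ) (j p : ℕ) :
    casoratian b j =
      (omegaRes (shift b j) p * coeffV b - omegaRes b p * coeffV (shift b j))
        - (kRes (shift b j) p * coeffV b - kRes b p * coeffV (shift b j)) := by
  simp only [casoratian, coeffW_eq_omegaRes_sub_kRes _ p]
  ring

/-- **(V-floor), OBSERVED (g8)**: `v_p(V(b)) ≥ −N_p(b)` — 0 violations in 1,428 window pairs (attained in 419), 80 pairs at
`p = b₀+1`, 112 pairs with `p² ≤ b₀+2` (269 vectors, b₀ ≤ 44); trivially true for `p > b₀+1` (`N_p = 0`, `V` `p`-integral).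
The same holds for `V` of `(t+c)²R_b`, hence for `V(b+e_j)` with `N_p(b)`. (The finer single-series law `a₇+T` of g5 §5d is
FALSE off the rays; this coarse floor is the invariant statement.) -/
@[conjecture] def ConstantTermFloorLaw : Prop :=
  ∀ (b : ℕ → ℤ) (p : ℕ), InPolytope b → p.Prime → 5 ≤ p → coeffV b ≠ 0 → -pairFloors b p ≤ padicValRat p (coeffV b)

/-- **(CV-𝒦), OBSERVED (g8)**: the `𝒦`-part of the Casoratian ALWAYS carries the refund:
`v_p(𝒦_p(b⁺)V(b) − 𝒦_p(b)V(b⁺)) ≥ 1 − N_p(b)` for every window prime — 0 violations in 1,428 window pairs (attained in 623)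
and 80 pairs at `p = b₀+1` (269 vectors, b₀ ≤ 44); `j`-independent (`= 𝒦(R₂)V − 𝒦(R)V₂`, `R₂ = (t+c)²R_b`).  With
`MomentVanishing`, `MomentIntegral` and (V-floor) it implies (CV) and explains its `[p ≤ d]` (see `CV_of_split`). -/
@[conjecture] def KResCasoratianLaw : Prop :=
  ∀ (b : ℕ → ℤ) (j p : ℕ), InPolytope b → 1 ≤ j → j ≤ 7 → InPolytope (shift b j) →
    p.Prime → 5 ≤ p → (b 0 + 2 : ℤ) < (p : ℤ) ^ 2 →
      kRes (shift b j) p * coeffV b - kRes b p * coeffV (shift b j) ≠ 0 →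
        1 - pairFloors b p ≤ padicValRat p (kRes (shift b j) p * coeffV b - kRes b p * coeffV (shift b j))

/-- **THE (CV) ROAD (g8)** (PROVED below, `cvRoad`): (CV) follows from the two observed laws and
the two moment lemmas by `casoratian_split` and `v(x − y) ≥ min(v x, v y)`:
for `p ≤ d` the `Ω`-bracket is `0`; for `p = d+1` it is `Ω_p(b⁺)V(b)` with `Ω_p(b⁺) = μ`'s `p`-integral and `v(V(b)) ≥ −N_p`;
for `p > d+1` both terms are `≥ −N_p`; and the `𝒦`-bracket is `≥ 1 − N_p ≥ law`.  (Needs also `N_p(b⁺) ≤ N_p(b)`.) -/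
def CVRoad : Prop :=
  MomentVanishing → MomentIntegral → ConstantTermFloorLaw → KResCasoratianLaw → CasoratianValuationLaw


/-! ### The reduction `CVRoad`, PROVED (valuation bookkeeping only) -/

section CVRoadProof

/-- `v_p(x) ≥ m` (for `x ≠ 0`) gives `‖x‖_p ≤ p^{−m}`. -/
theorem padicNorm_le_of_val {p : ℕ} [hp : Fact p.Prime] {x : ℚ} {m : ℤ} (h : x ≠ 0 → m ≤ padicValRat p x) :
    padicNorm p x ≤ (p : ℚ) ^ (-m) := by
  by_cases hx : x = 0
  · subst hx; simp only [padicNorm.zero]; positivity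
  · rw [padicNorm.eq_zpow_of_nonzero hx]
    have h1 : (1 : ℚ) ≤ p := by exact_mod_cast hp.out.one_lt.le
    exact zpow_le_zpow_right₀ h1 (neg_le_neg (h hx))

/-- `‖x‖_p ≤ p^{−m}` and `x ≠ 0` give `v_p(x) ≥ m`. -/
theorem val_ge_of_padicNorm_le {p : ℕ} [hp : Fact p.Prime] {x : ℚ} {m : ℤ} (hx : x ≠ 0)
    (h : padicNorm p x ≤ (p : ℚ) ^ (-m)) : m ≤ padicValRat p x := by
  rw [padicNorm.eq_zpow_of_nonzero hx] at h
  have h1 : (1 : ℚ) < p := by exact_mod_cast hp.out.one_lt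
  have := (zpow_le_zpow_iff_right₀ h1).1 h
  linarith

/-- `N_p(b + e_j) ≤ N_p(b)`: raising a lower parameter shrinks every pair brick. -/
theorem pairFloors_shift_le (b : ℕ → ℤ) {j : ℕ} (hj1 : 1 ≤ j) (p : ℕ) (hp : 0 < p) :
    pairFloors (shift b j) p ≤ pairFloors b p := by
  unfold pairFloors shift
  have h0 : Function.update b j (b j + 1) 0 = b 0 := by
    rw [Function.update_of_ne]; omega
  have hup : ∀ i, b (i + 1) ≤ Function.update b j (b j + 1) (i + 1) := by
    intro i
    rcases eq_or_ne (i + 1) j with h | h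
    · rw [← h, Function.update_self]; linarith
    · rw [Function.update_of_ne h]
  apply Finset.sum_le_sum; intro i _; apply Finset.sum_le_sum; intro k _
  split_ifs with hik
  · rw [h0]
    apply Int.ediv_le_ediv (by exact_mod_cast hp)
    linarith [hup i, hup k]
  · exact le_rfl

/-- **`CVRoad` holds**: (CV) follows from `MomentVanishing`, `MomentIntegral`, (V-floor) and (CV-𝒦). -/
theorem cvRoad : CVRoad := by
  intro hMV hMI hV hK b j p hb hj1 hj7 hb' hpp h5 hwin hcas
  haveI : Fact p.Prime := ⟨hpp⟩
  have hp1 : (1 : ℚ) < p := by exact_mod_cast hpp.one_lt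
  have hd0 : 0 ≤ dOf b := by
    have := hb.2.2; unfold dOf; linarith
  have hdshift : dOf (shift b j) = dOf b - 1 := BigPrime.dOf_shift b hj1 hj7
  have hN' : pairFloors (shift b j) p ≤ pairFloors b p := pairFloors_shift_le b hj1 p hpp.pos
  -- the constant terms
  have hVb : padicNorm p (coeffV b) ≤ (p : ℚ) ^ pairFloors b p := by
    have h1 := padicNorm_le_of_val (p := p) (x := coeffV b) (m := -pairFloors b p)
      (fun h => by simpa using hV b p hb hpp h5 h)
    simpa using h1
  have hVb' : padicNorm p (coeffV (shift b j)) ≤ (p : ℚ) ^ pairFloors b p := by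
    have h1 := padicNorm_le_of_val (p := p) (x := coeffV (shift b j)) (m := -pairFloors (shift b j) p)
      (fun h => by simpa using hV _ p hb' hpp h5 h)
    refine h1.trans ?_
    rw [neg_neg]; exact zpow_le_zpow_right₀ hp1.le hN'
  -- the 𝒦-bracket
  have hBb : padicNorm p (kRes (shift b j) p * coeffV b - kRes b p * coeffV (shift b j))
      ≤ (p : ℚ) ^ (-(1 - pairFloors b p)) :=
    padicNorm_le_of_val (fun h => hK b j p hb hj1 hj7 hb' hpp h5 hwin h)
  -- the moments
  have hμ : ∀ b' : ℕ → ℤ, InPolytope b' → ∀ N, padicNorm p (momentAt b' N) ≤ 1 := fun b' hb'' N => by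
    have h1 := padicNorm_le_of_val (p := p) (x := momentAt b' N) (m := 0)
      (fun h => hMI b' N p hb'' hpp (by omega) h)
    simpa using h1
  have h2norm : padicNorm p (2 : ℚ) ≤ 1 := by simpa using padicNorm.of_int (p := p) 2
  have hΩint : ∀ b' : ℕ → ℤ, InPolytope b' → padicNorm p (omegaRes b' p) ≤ 1 := by
    intro b' hb''
    rw [omegaRes_eq_moments]
    have hA : padicNorm p (2 * momentAt b' (p + 2)) ≤ 1 := by
      rw [padicNorm.mul]
      calc padicNorm p 2 * padicNorm p (momentAt b' (p + 2)) ≤ 1 * 1 :=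
            mul_le_mul h2norm (hμ b' hb'' _) (padicNorm.nonneg _) zero_le_one
        _ = 1 := one_mul 1
    calc padicNorm p (momentAt b' (2 * p + 1) - 2 * momentAt b' (p + 2) + momentAt b' 3)
        ≤ max (padicNorm p (momentAt b' (2 * p + 1) - 2 * momentAt b' (p + 2))) (padicNorm p (momentAt b' 3)) :=
          padicNorm.nonarchimedean
      _ ≤ max (max (padicNorm p (momentAt b' (2 * p + 1))) (padicNorm p (2 * momentAt b' (p + 2))))
            (padicNorm p (momentAt b' 3)) := max_le_max padicNorm.sub le_rfl
      _ ≤ 1 := max_le (max_le (hμ b' hb'' _) hA) (hμ b' hb'' _)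
  have hΩzero : ∀ b' : ℕ → ℤ, InPolytope b' → (p : ℤ) ≤ dOf b' + 1 → omegaRes b' p = 0 := by
    intro b' hb'' hpd
    have hd0' : 0 ≤ dOf b' := by
      have := hb''.2.2; unfold dOf; linarith
    rw [omegaRes_eq_moments, hMV b' (2 * p + 1) hb'' (by omega) (by push_cast; omega),
      hMV b' (p + 2) hb'' (by omega) (by push_cast; omega), hMV b' 3 hb'' (by omega) (by push_cast; omega)]
    ring
  -- assemble
  apply val_ge_of_padicNorm_le hcas
  rw [casoratian_split b j p]
  by_cases hpd : (p : ℤ) ≤ dOf b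
  · have h1 : omegaRes b p = 0 := hΩzero b hb (by omega)
    have h2 : omegaRes (shift b j) p = 0 := hΩzero _ hb' (by rw [hdshift]; omega)
    rw [h1, h2, zero_mul, zero_mul, sub_zero, zero_sub, padicNorm.neg]
    refine hBb.trans (zpow_le_zpow_right₀ hp1.le ?_)
    have : refund b p ≤ 1 := min_le_left _ _
    linarith
  · have hr : refund b p = 0 := by
      unfold refund
      rw [Int.ediv_eq_zero_of_lt hd0 (by omega)]; simp
    rw [hr, zero_sub, neg_neg]
    calc padicNorm p ((omegaRes (shift b j) p * coeffV b - omegaRes b p * coeffV (shift b j))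
            - (kRes (shift b j) p * coeffV b - kRes b p * coeffV (shift b j)))
        ≤ max (padicNorm p (omegaRes (shift b j) p * coeffV b - omegaRes b p * coeffV (shift b j)))
            (padicNorm p (kRes (shift b j) p * coeffV b - kRes b p * coeffV (shift b j))) := padicNorm.sub
      _ ≤ (p : ℚ) ^ pairFloors b p := max_le ?_ ?_
    · calc padicNorm p (omegaRes (shift b j) p * coeffV b - omegaRes b p * coeffV (shift b j))
          ≤ max (padicNorm p (omegaRes (shift b j) p * coeffV b)) (padicNorm p (omegaRes b p * coeffV (shift b j))) :=
            padicNorm.sub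
        _ ≤ (p : ℚ) ^ pairFloors b p := max_le ?_ ?_
      · rw [padicNorm.mul]
        calc padicNorm p (omegaRes (shift b j) p) * padicNorm p (coeffV b) ≤ 1 * (p : ℚ) ^ pairFloors b p :=
              mul_le_mul (hΩint _ hb') hVb (padicNorm.nonneg _) zero_le_one
          _ = _ := one_mul _
      · rw [padicNorm.mul]
        calc padicNorm p (omegaRes b p) * padicNorm p (coeffV (shift b j)) ≤ 1 * (p : ℚ) ^ pairFloors b p :=
              mul_le_mul (hΩint _ hb) hVb' (padicNorm.nonneg _) zero_le_one
          _ = _ := one_mul _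
    · refine hBb.trans (zpow_le_zpow_right₀ hp1.le ?_)
      linarith

/-- The road as a usable implication. -/
theorem casoratianValuationLaw_of (hMV : MomentVanishing) (hMI : MomentIntegral) (hV : ConstantTermFloorLaw)
    (hK : KResCasoratianLaw) : CasoratianValuationLaw :=
  cvRoad hMV hMI hV hK

end CVRoadProof

end Summit.KontsevichZagierPeriods.Zeta5Search.ClusterValuation
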